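import Literature.NumberTheory.Automorphic.QuadraticLocalNormResidueBridge
import Literature.NumberTheory.Automorphic.Liu2021.LemD1AsPrintedIndexedNonVacuityNonsplitPlace
import Literature.NumberTheory.Automorphic.Liu2021.LemD1IsotropyOfPlace
import Literature.NumberTheory.QuadraticForms.LocalNormIndex
import HarnessLib

/-!
# The local norm group at a non-split place in `E_v`-currency: `σ`-fixed units of `E_v = E ⊗_F F_v` modulo `{σ(z) z}` has order `2`
# (O'Meara 63:13; Rogawski 1990, §3.5 Prop. 3.5.2 (a) `H¹(F,T) ≅ L∕N_{L′∕L}(L′^*)`)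

Topic `NumberTheory/Automorphic`; namespace `Literature.NumberTheory.Automorphic.UnitaryGroup` (home of ★ `LocalRing E v`, ★ `conjLocal`, ★ `toLocalRing`).  **THEOREMS
ONLY** (no definition, no named fact, no instance, no notation, no `sorry`).  Cell `pub/hodgecm-mathlib`, programme P3a, road «D-N7-inert» (inert unit fundamental
lemma [Rogawski1990, Prop. 4.9.1 (b)]), brick **(L4a) «LOCAL CLASS SET + κ_H»**: the group-theoretic input of the type (1) count ★ `LocalStableClassesNonsplitTypeOneCount`
— the local Cartan classes of ★ `LocalStableClassesNonsplit` are `σ`-fixed units of `E_v` read modulo NORMS `σ(z) z`, and this file packages, in that currency, the bridge ★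
`exists_isUnit_toLocalRing_eq_mul_conjLocal_iff` (unit-norm test = Hilbert symbol = membership in ★ `quadraticNormSubgroup`) with the local norm index ★
`index_quadraticNormSubgroup_adicCompletion_eq_two` (O'Meara 63:13, via ★ `not_isSquare_delta_sq_of_nonsplit`).  HC_CM is proved only modulo the printed
citations until rung 0 closes; this file is unconditional local algebra.

SETTING.  `E ∕ F` quadratic number fields, `c δ = −δ ≠ 0` (so `δ² = d ∈ F`), `v` a finite place of `F`, `σ = c ⊗ 1` on `E_v = ∏_{w ∣ v} E_w`, `ι_v = toLocalRing E v`;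
«`r` is a norm» means `∃ z unit, r = σ(z) z`.  At a place `w ∣ v` with `c • w = w` (non-split) `E_v` is a field.
* §1 `σ`-fixed units are `ι_v(p)`, `p ∈ F_vˣ` (`exists_ne_zero_toLocalRing_eq_of_conjLocal_eq`); the norm test on `ι_v(p)` is `p ∈ N := quadraticNormSubgroup F_v d`
  (`exists_toLocalRing_eq_norm_iff_mem`); `[F_vˣ : N] = 2` at a non-split `v` (★ `index_norms_eq_two_of_nonsplit`); hence a NON-NORM `σ`-fixed unit
  exists (`exists_conjLocal_eq_not_exists_norm`) and two non-norms differ by a norm (`exists_norm_mul_of_not_exists_norm`).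
* §2 CONSEQUENCES FOR NORM TESTS «`a ∈ N(z) · g`» between `σ`-fixed units: `a′ = N(z) a` iff the tests of `a′`, `a` against `g` agree
  (`exists_norm_mul_iff_norm_tests_iff`); a `σ`-fixed unit ratio is `ι_v(p)` with test = `p ∈ N` (`exists_eq_toLocalRing_mul_and_norm_iff`); and the PARITY LAW: if
  `∏ᵢ aᵢ ∈ N(z) · ∏ᵢ gᵢ` for `i ∈ Fin 3` then test `0` passes iff tests `1`, `2` agree (`norm_test_zero_iff_one_iff_two` — the «`Σ εⱼ = 0`» of [Prop. 3.5.2 (c)]).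

## References
* [Omeara1963] O. T. O'Meara, *Introduction to Quadratic Forms* (1963), §63B Prop. 63:13, §65A.
* [Rogawski1990] J. D. Rogawski, *Automorphic Representations of Unitary Groups in Three Variables*, Ann. of Math. Stud. 123 (1990), §3.5 Prop. 3.5.2 (a)(c) p. 29.
* [CasselsFrohlichANT1967] Cassels–Fröhlich (eds.), *Algebraic Number Theory* (1967), Ch. II §10.
-/

set_option autoImplicit false

noncomputable section

open NumberField IsDedekindDomain

namespace Literature.NumberTheory.Automorphic.UnitaryGroup

open Literature.NumberTheory.QuadraticForms

/-! ## §1 `σ`-fixed units of `E_v` modulo norms: index two at a non-split place -/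

section LocalNorms

variable {F : Type} (E : Type) [Field F] [NumberField F] [Field E] [NumberField E] [Algebra F E]
  [Algebra.IsQuadraticExtension F E] (v : HeightOneSpectrum (𝓞 F)) (c : E ≃ₐ[F] E) {δ : E} (hcδ : c δ = -δ) (hδ : δ ≠ 0)

include hcδ hδ in
/-- `δ² ∈ F`: for a quadratic `E∕F` and `c δ = -δ ≠ 0` there is `d ∈ F` with `δ · δ = d` (as in ★ `LemD1IndexedNonVacuityNonsplitPlace`, private there). [folklore] -/
private theorem exists_delta_mul_self_eq_algebraMap' : ∃ d : F, δ * δ = algebraMap F E d := by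
  obtain ⟨x, y, hxy⟩ := exists_eq_add_mul_of_isQuadraticExtension (F := F) (E := E)
    (not_mem_range_algebraMap_of_apply_eq_neg E c hcδ hδ) (δ * δ)
  have hc2 : c (δ * δ) = δ * δ := by rw [map_mul, hcδ, neg_mul_neg]
  have hy : algebraMap F E y * δ = 0 := by
    have h1 : c (δ * δ) = algebraMap F E x - algebraMap F E y * δ := by
      rw [hxy, map_add, map_mul, AlgEquiv.commutes, AlgEquiv.commutes, hcδ, mul_neg, sub_eq_add_neg]
    rw [hc2, hxy] at h1
    have h2 : (2 : E) * (algebraMap F E y * δ) = 0 := by linear_combination h1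
    exact (mul_eq_zero.1 h2).resolve_left two_ne_zero
  exact ⟨x, by rw [hxy, hy, add_zero]⟩

include hcδ hδ in
/-- **A `σ`-fixed unit of `E_v` comes from `F_vˣ`**: `conjLocal r = r`, `r` a unit ⟹ `r = ι_v(p)` with `p ≠ 0` (★ `exists_toLocalRing_eq_of_conjLocal_eq`).
[cite: CasselsFrohlichANT1967, Ch. II §10] -/
theorem exists_ne_zero_toLocalRing_eq_of_conjLocal_eq {r : LocalRing E v} (hr : conjLocal E c v r = r) (hru : IsUnit r) :
    ∃ p : v.adicCompletion F, p ≠ 0 ∧ toLocalRing E v p = r := by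
  obtain ⟨p, hp⟩ := Liu2021.LemD1OfPlace.exists_toLocalRing_eq_of_conjLocal_eq E v c hcδ hδ r hr
  refine ⟨p, ?_, hp⟩
  rintro rfl
  rw [map_zero] at hp
  rw [← hp] at hru
  exact not_isUnit_zero hru

include hcδ hδ in
/-- **The unit-norm test on `ι_v(p)` is membership of `p` in the norm group** `N = quadraticNormSubgroup F_v d` (`δ² = d`): `(∃ z unit, ι_v p = σ(z) z) ↔
p ∈ N` (★ `exists_isUnit_toLocalRing_eq_mul_conjLocal_iff` with ★ `hilbertSymbol_eq_one_iff_mem_quadraticNormSubgroup`). [cite: Omeara1963, §63B with §65A] -/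
theorem exists_toLocalRing_eq_norm_iff_mem {d : F} (hd : δ * δ = algebraMap F E d) {p : v.adicCompletion F} (hp : p ≠ 0) :
    (∃ z : LocalRing E v, IsUnit z ∧ toLocalRing E v p = conjLocal E c v z * z) ↔
      Units.mk0 p hp ∈ quadraticNormSubgroup (v.adicCompletion F) (d : v.adicCompletion F) := by
  haveI : CharZero (v.adicCompletion F) := charZero_of_injective_algebraMap (algebraMap F (v.adicCompletion F)).injective
  haveI : NeZero (2 : v.adicCompletion F) := ⟨two_ne_zero⟩
  have hd0 : (d : v.adicCompletion F) ≠ 0 := by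
    intro h
    have hd0' : d = 0 := (algebraMap F (v.adicCompletion F)).injective (by rw [map_zero]; exact h)
    rw [hd0', map_zero, mul_self_eq_zero] at hd
    exact hδ hd
  have e : (∃ z : LocalRing E v, IsUnit z ∧ toLocalRing E v p = conjLocal E c v z * z) ↔
      ∃ z : LocalRing E v, IsUnit z ∧ toLocalRing E v p = z * conjLocal E c v z :=
    exists_congr fun z => by rw [mul_comm]
  have hb := hilbertSymbol_eq_one_iff_mem_quadraticNormSubgroup hd0 (Units.mk0 p hp)
  rw [Units.val_mk0] at hb
  rw [e, exists_isUnit_toLocalRing_eq_mul_conjLocal_iff E c hcδ hδ hd v hp, hb]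

include hcδ hδ in
/-- **A NON-NORM `σ`-fixed unit exists at a non-split place**: some `r = ι_v(p)`, `p ∈ F_vˣ ∖ N`, is `σ`-fixed, a unit, and NOT of the form `σ(z) z`
(index `2` ⇒ `N ≠ F_vˣ`).  [cite: Omeara1963, §63B Prop. 63:13] [cite: Rogawski1990, §3.5 Prop. 3.5.2 (a) p. 29] -/
theorem exists_conjLocal_eq_not_exists_norm (w : PlacesOver E v) (hw : c • w.1 = w.1) :
    ∃ r : LocalRing E v, conjLocal E c v r = r ∧ IsUnit r ∧ ¬ ∃ z : LocalRing E v, IsUnit z ∧ r = conjLocal E c v z * z := by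
  obtain ⟨d, hd⟩ := exists_delta_mul_self_eq_algebraMap' E c hcδ hδ
  have h2 := Liu2021.LemD1IndexedNonVacuityNonsplitPlace.index_norms_eq_two_of_nonsplit E v c hcδ hδ w hw hd
  have hne : quadraticNormSubgroup (v.adicCompletion F) (d : v.adicCompletion F) ≠ ⊤ := by
    intro htop; rw [htop, Subgroup.index_top] at h2; exact absurd h2 (by norm_num)
  obtain ⟨t, ht⟩ : ∃ t : (v.adicCompletion F)ˣ, t ∉ quadraticNormSubgroup (v.adicCompletion F) (d : v.adicCompletion F) := by
    by_contra! hall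
    exact hne ((Subgroup.eq_top_iff' _).mpr hall)
  refine ⟨toLocalRing E v (t : v.adicCompletion F), conjLocal_toLocalRing c v _, (t.isUnit).map _, fun h => ht ?_⟩
  rw [← Units.mk0_val t t.ne_zero]
  exact (exists_toLocalRing_eq_norm_iff_mem E v c hcδ hδ hd t.ne_zero).1 h

include hcδ hδ in
/-- **Two NON-NORMS differ by a norm** (index `2`): for `σ`-fixed units `a, a′` of `E_v` at a non-split place, neither of the form `σ(z) z`, there is a unit
`z` with `a′ = σ(z) z · a`.  [cite: Omeara1963, §63B Prop. 63:13] [cite: Rogawski1990, §3.5 Prop. 3.5.2 (a) p. 29] -/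
theorem exists_norm_mul_of_not_exists_norm (w : PlacesOver E v) (hw : c • w.1 = w.1) {a a' : LocalRing E v}
    (ha : conjLocal E c v a = a) (hau : IsUnit a) (ha' : conjLocal E c v a' = a') (ha'u : IsUnit a')
    (hna : ¬ ∃ z : LocalRing E v, IsUnit z ∧ a = conjLocal E c v z * z) (hna' : ¬ ∃ z : LocalRing E v, IsUnit z ∧ a' = conjLocal E c v z * z) :
    ∃ z : LocalRing E v, IsUnit z ∧ a' = conjLocal E c v z * z * a := by
  letI : Field (LocalRing E v) :=
    (Liu2021.LemD1IndexedNonVacuityNonsplitPlace.isField_localRing_of_nonsplit E v c hcδ hδ w hw).toField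
  obtain ⟨d, hd⟩ := exists_delta_mul_self_eq_algebraMap' E c hcδ hδ
  have h2 := Liu2021.LemD1IndexedNonVacuityNonsplitPlace.index_norms_eq_two_of_nonsplit E v c hcδ hδ w hw hd
  obtain ⟨p, hp, rfl⟩ := exists_ne_zero_toLocalRing_eq_of_conjLocal_eq E v c hcδ hδ ha hau
  obtain ⟨p', hp', rfl⟩ := exists_ne_zero_toLocalRing_eq_of_conjLocal_eq E v c hcδ hδ ha' ha'u
  have hnp : Units.mk0 p hp ∉ quadraticNormSubgroup (v.adicCompletion F) (d : v.adicCompletion F) := fun h =>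
    hna ((exists_toLocalRing_eq_norm_iff_mem E v c hcδ hδ hd hp).2 h)
  have hnp' : Units.mk0 p' hp' ∉ quadraticNormSubgroup (v.adicCompletion F) (d : v.adicCompletion F) := fun h =>
    hna' ((exists_toLocalRing_eq_norm_iff_mem E v c hcδ hδ hd hp').2 h)
  -- `p p′ ∈ N`
  have hpp : Units.mk0 (p * p') (mul_ne_zero hp hp') ∈ quadraticNormSubgroup (v.adicCompletion F) (d : v.adicCompletion F) := by
    rw [Units.mk0_mul, Subgroup.mul_mem_iff_of_index_two h2]
    exact ⟨fun h => absurd h hnp, fun h => absurd h hnp'⟩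
  obtain ⟨z, hz, hzz⟩ := (exists_toLocalRing_eq_norm_iff_mem E v c hcδ hδ hd (mul_ne_zero hp hp')).2 hpp
  -- `ι p′ = σ(z ι(p⁻¹)) (z ι(p⁻¹)) · ι p` (the inverse is taken in `F_v`, not in the product ring)
  have hinv : toLocalRing E v p⁻¹ * toLocalRing E v p = 1 := by rw [← map_mul, inv_mul_cancel₀ hp, map_one]
  refine ⟨z * toLocalRing E v p⁻¹, hz.mul ((IsUnit.mk0 _ (inv_ne_zero hp)).map _), ?_⟩
  rw [map_mul (conjLocal E c v), conjLocal_toLocalRing]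
  rw [map_mul] at hzz
  calc toLocalRing E v p' = toLocalRing E v p⁻¹ * (toLocalRing E v p * toLocalRing E v p') := by
        rw [← mul_assoc, hinv, one_mul]
    _ = toLocalRing E v p⁻¹ * (conjLocal E c v z * z) := by rw [hzz]
    _ = conjLocal E c v z * z * toLocalRing E v p⁻¹ * (toLocalRing E v p⁻¹ * toLocalRing E v p) := by rw [hinv, mul_one]; ring
    _ = conjLocal E c v z * toLocalRing E v p⁻¹ * (z * toLocalRing E v p⁻¹) * toLocalRing E v p := by ring

end LocalNorms

/-! ## §2 Norm tests between `σ`-fixed units: relations, ratios, and the parity law -/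

section Tests

variable {F : Type} (E : Type) [Field F] [NumberField F] [Field E] [NumberField E] [Algebra F E]
  [Algebra.IsQuadraticExtension F E] (v : HeightOneSpectrum (𝓞 F)) (c : E ≃ₐ[F] E) {δ : E} (hcδ : c δ = -δ) (hδ : δ ≠ 0)

/-- Inverse-free bookkeeping for norms: `N(z) · N(z′) = N(z z′)`. [folklore] -/
private theorem norm_mul_norm' {R : Type*} [CommRing R] (σ : R →+* R) (z z' : R) :
    σ z * z * (σ z' * z') = σ (z * z') * (z * z') := by rw [map_mul]; ring

/-- Inverse-free bookkeeping for norms: a unit `z` has `N(z) · N(z⁻¹) = 1`. [folklore] -/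
private theorem exists_norm_mul_norm_eq_one {R : Type*} [CommRing R] (σ : R →+* R) {z : R} (hz : IsUnit z) :
    ∃ z' : R, IsUnit z' ∧ σ z * z * (σ z' * z') = 1 := by
  refine ⟨(hz.unit⁻¹ : Rˣ), Units.isUnit _, ?_⟩
  rw [norm_mul_norm', IsUnit.mul_val_inv, map_one, mul_one]

include hcδ hδ in
/-- **Norm relations versus norm tests.**  For `σ`-fixed units `a, a′, g` of `E_v` at a non-split place: `a′ = N(z) a` for some unit `z` **iff** the two
tests «`a′ ∈ N(z) g`», «`a ∈ N(z) g`» agree — (→) by multiplying norms, (←) when both fail by §2 `exists_norm_mul_of_not_exists_norm` (index `2`).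
[cite: Rogawski1990, §3.5 Prop. 3.5.2 (a) p. 29] [cite: Omeara1963, §63B Prop. 63:13] -/
theorem exists_norm_mul_iff_norm_tests_iff (w : PlacesOver E v) (hw : c • w.1 = w.1) {a a' g : LocalRing E v}
    (ha : conjLocal E c v a = a) (hau : IsUnit a) (ha' : conjLocal E c v a' = a') (ha'u : IsUnit a')
    (hg : conjLocal E c v g = g) (hgu : IsUnit g) :
    (∃ z : LocalRing E v, IsUnit z ∧ a' = conjLocal E c v z * z * a) ↔
      ((∃ z : LocalRing E v, IsUnit z ∧ a' = conjLocal E c v z * z * g) ↔ (∃ z : LocalRing E v, IsUnit z ∧ a = conjLocal E c v z * z * g)) := by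
  set σ := conjLocal E c v with hσ
  constructor
  · rintro ⟨z, hz, h⟩
    obtain ⟨zi, hzi, hzzi⟩ := exists_norm_mul_norm_eq_one σ hz
    constructor
    · rintro ⟨z₂, hz₂, h₂⟩
      refine ⟨zi * z₂, hzi.mul hz₂, ?_⟩
      calc a = σ z * z * (σ zi * zi) * a := by rw [hzzi, one_mul]
        _ = σ zi * zi * a' := by rw [h]; ring
        _ = σ (zi * z₂) * (zi * z₂) * g := by rw [h₂, ← mul_assoc, norm_mul_norm']
    · rintro ⟨z₁, hz₁, h₁⟩
      exact ⟨z * z₁, hz.mul hz₁, by rw [h, h₁, ← mul_assoc, norm_mul_norm']⟩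
  · intro h
    by_cases hT : ∃ z : LocalRing E v, IsUnit z ∧ a = σ z * z * g
    · obtain ⟨z₁, hz₁, h₁⟩ := hT
      obtain ⟨z₂, hz₂, h₂⟩ := h.2 ⟨z₁, hz₁, h₁⟩
      obtain ⟨zi, hzi, hzzi⟩ := exists_norm_mul_norm_eq_one σ hz₁
      refine ⟨z₂ * zi, hz₂.mul hzi, ?_⟩
      calc a' = σ z₂ * z₂ * (σ z₁ * z₁ * (σ zi * zi)) * g := by rw [hzzi, mul_one, h₂]
        _ = σ (z₂ * zi) * (z₂ * zi) * a := by rw [h₁, ← norm_mul_norm']; ring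
    · have hT' : ¬ ∃ z : LocalRing E v, IsUnit z ∧ a' = σ z * z * g := fun h' => hT (h.1 h')
      -- `a g⁻¹`, `a′ g⁻¹` are non-norms; index two
      obtain ⟨gi, hgiu, hggi⟩ : ∃ gi : LocalRing E v, IsUnit gi ∧ g * gi = 1 := ⟨(hgu.unit⁻¹ : (LocalRing E v)ˣ), Units.isUnit _, hgu.mul_val_inv⟩
      have hσσ : ∀ s, σ (σ s) = s := Liu2021.LemD1OfPlace.conjLocal_conjLocal_apply E v c hcδ hδ
      have hgi : σ gi = gi := by
        -- `σ(gi) = σ(gi) (g gi) = (σ g gi)… `: `σ gi * g = σ (gi g) = 1` so `σ gi = gi`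
        have h1 : σ gi * g = 1 := by rw [← hg, ← map_mul, mul_comm, hggi, map_one]
        calc σ gi = σ gi * (g * gi) := by rw [hggi, mul_one]
          _ = gi := by rw [← mul_assoc, h1, one_mul]
      have hna : ¬ ∃ z : LocalRing E v, IsUnit z ∧ a * gi = σ z * z := by
        rintro ⟨z, hz, hz'⟩
        exact hT ⟨z, hz, by rw [← hz', mul_assoc, mul_comm gi, hggi, mul_one]⟩
      have hna' : ¬ ∃ z : LocalRing E v, IsUnit z ∧ a' * gi = σ z * z := by
        rintro ⟨z, hz, hz'⟩
        exact hT' ⟨z, hz, by rw [← hz', mul_assoc, mul_comm gi, hggi, mul_one]⟩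
      obtain ⟨z, hz, hzz⟩ := exists_norm_mul_of_not_exists_norm E v c hcδ hδ w hw
        (by rw [map_mul, ha, hgi]) (hau.mul hgiu) (by rw [map_mul, ha', hgi]) (ha'u.mul hgiu) hna hna'
      refine ⟨z, hz, ?_⟩
      calc a' = a' * gi * g := by rw [mul_assoc, mul_comm gi, hggi, mul_one]
        _ = σ z * z * (a * gi) * g := by rw [hzz]
        _ = σ z * z * a := by rw [mul_assoc (σ z * z), mul_assoc a, mul_comm gi, hggi, mul_one]


include hcδ hδ in
/-- **A `σ`-fixed unit ratio**: for `σ`-fixed units `a, g` of `E_v` there is `p ∈ F_vˣ` with `a = ι_v(p) · g`, and then «`a ∈ N(z) · g`» iff `p ∈ N`.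
[cite: Rogawski1990, §3.5 Prop. 3.5.2 (a) p. 29] [cite: Omeara1963, §65A] -/
theorem exists_eq_toLocalRing_mul_and_norm_iff {d : F} (hd : δ * δ = algebraMap F E d)
    {a g : LocalRing E v} (ha : conjLocal E c v a = a) (hau : IsUnit a) (hg : conjLocal E c v g = g) (hgu : IsUnit g) :
    ∃ (p : v.adicCompletion F) (hp : p ≠ 0), a = toLocalRing E v p * g ∧
      ((∃ z : LocalRing E v, IsUnit z ∧ a = conjLocal E c v z * z * g) ↔
        Units.mk0 p hp ∈ quadraticNormSubgroup (v.adicCompletion F) (d : v.adicCompletion F)) := by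
  obtain ⟨gi, hgiu, hggi⟩ : ∃ gi : LocalRing E v, IsUnit gi ∧ g * gi = 1 := ⟨(hgu.unit⁻¹ : (LocalRing E v)ˣ), Units.isUnit _, hgu.mul_val_inv⟩
  have hgi : conjLocal E c v gi = gi := by
    have h1 : conjLocal E c v gi * g = 1 := by rw [← hg, ← map_mul, mul_comm, hggi, map_one]
    calc conjLocal E c v gi = conjLocal E c v gi * (g * gi) := by rw [hggi, mul_one]
      _ = gi := by rw [← mul_assoc, h1, one_mul]
  obtain ⟨p, hp, hpe⟩ := exists_ne_zero_toLocalRing_eq_of_conjLocal_eq E v c hcδ hδ (r := a * gi) (by rw [map_mul, ha, hgi]) (hau.mul hgiu)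
  refine ⟨p, hp, ?_, ?_⟩
  · rw [hpe, mul_assoc, mul_comm gi, hggi, mul_one]
  · rw [← exists_toLocalRing_eq_norm_iff_mem E v c hcδ hδ hd hp, hpe]
    refine exists_congr fun z => and_congr_right fun _ => ?_
    constructor
    · intro h; rw [h, mul_assoc, hggi, mul_one]
    · intro h
      calc a = a * gi * g := by rw [mul_assoc, mul_comm gi, hggi, mul_one]
        _ = conjLocal E c v z * z * g := by rw [h]


/-- Group-theoretic parity behind «`Σ εⱼ = 0`»: for a subgroup `Q` of index `2` and `x₀ x₁ x₂ ∈ Q`, membership of the three factors has EVEN failure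
set — `x₀ ∈ Q ↔ (x₁ ∈ Q ↔ x₂ ∈ Q)` (Mathlib `Subgroup.mul_mem_iff_of_index_two`). [folklore] -/
private theorem mem_iff_mem_iff_mem_of_index_two {G : Type*} [CommGroup G] {Q : Subgroup G} (hQ : Q.index = 2) {x₀ x₁ x₂ : G}
    (h : x₀ * x₁ * x₂ ∈ Q) : x₀ ∈ Q ↔ (x₁ ∈ Q ↔ x₂ ∈ Q) := by
  rw [mul_assoc, Subgroup.mul_mem_iff_of_index_two hQ, Subgroup.mul_mem_iff_of_index_two hQ] at h
  tauto


include hcδ hδ in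
/-- **THE PARITY LAW** (the «`Σ εⱼ = 0`» of [Prop. 3.5.2 (c)] in `E_v`-currency): for `σ`-fixed units `aᵢ, gᵢ` (`i ∈ Fin 3`) of `E_v` at a non-split place with
`∏ᵢ aᵢ = N(z) · ∏ᵢ gᵢ`, the norm test «`aᵢ ∈ N · gᵢ`» passes at `0` iff the tests at `1` and `2` agree — in `F_vˣ ∕ N ≅ ℤ∕2` the three ratio classes sum to zero
(index `2`, Mathlib `Subgroup.mul_mem_iff_of_index_two`). [cite: Rogawski1990, §3.5 Prop. 3.5.2 (c) p. 29] [cite: Omeara1963, §63B Prop. 63:13] -/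
theorem norm_test_zero_iff_one_iff_two (w : PlacesOver E v) (hw : c • w.1 = w.1) {a g : Fin 3 → LocalRing E v}
    (ha : ∀ i, conjLocal E c v (a i) = a i) (hau : ∀ i, IsUnit (a i)) (hg : ∀ i, conjLocal E c v (g i) = g i) (hgu : ∀ i, IsUnit (g i))
    (hprod : ∃ z : LocalRing E v, IsUnit z ∧ a 0 * a 1 * a 2 = conjLocal E c v z * z * (g 0 * g 1 * g 2)) :
    (∃ z : LocalRing E v, IsUnit z ∧ a 0 = conjLocal E c v z * z * g 0) ↔
      ((∃ z : LocalRing E v, IsUnit z ∧ a 1 = conjLocal E c v z * z * g 1) ↔ (∃ z : LocalRing E v, IsUnit z ∧ a 2 = conjLocal E c v z * z * g 2)) := by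
  letI : Field (LocalRing E v) :=
    (Liu2021.LemD1IndexedNonVacuityNonsplitPlace.isField_localRing_of_nonsplit E v c hcδ hδ w hw).toField
  obtain ⟨d, hd⟩ := exists_delta_mul_self_eq_algebraMap' E c hcδ hδ
  have h2 := Liu2021.LemD1IndexedNonVacuityNonsplitPlace.index_norms_eq_two_of_nonsplit E v c hcδ hδ w hw hd
  have hrat := fun i => exists_eq_toLocalRing_mul_and_norm_iff E v c hcδ hδ hd (ha i) (hau i) (hg i) (hgu i)
  choose p hp hpe hiff using hrat
  obtain ⟨z, hz, hprod⟩ := hprod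
  rw [hpe 0, hpe 1, hpe 2] at hprod
  have hG0 : g 0 * g 1 * g 2 ≠ 0 := mul_ne_zero (mul_ne_zero (hgu 0).ne_zero (hgu 1).ne_zero) (hgu 2).ne_zero
  have hι : toLocalRing E v (p 0 * p 1 * p 2) = conjLocal E c v z * z := by
    apply mul_right_cancel₀ hG0
    rw [map_mul, map_mul]
    linear_combination hprod
  have hmem : Units.mk0 (p 0 * p 1 * p 2) (mul_ne_zero (mul_ne_zero (hp 0) (hp 1)) (hp 2)) ∈
      quadraticNormSubgroup (v.adicCompletion F) (d : v.adicCompletion F) :=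
    (exists_toLocalRing_eq_norm_iff_mem E v c hcδ hδ hd _).1 ⟨z, hz, hι⟩
  rw [Units.mk0_mul, Units.mk0_mul] at hmem
  rw [hiff 0, hiff 1, hiff 2]
  exact mem_iff_mem_iff_mem_of_index_two h2 hmem

end Tests

end Literature.NumberTheory.Automorphic.UnitaryGroup

end
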